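import Mathlib
import Summits.SmoothPoincare4.Statement
import Summits.SmoothPoincare4.SmoothPoincare4.Theses.RootDecompY
import Literature.Topology.FourManifolds.ConnectedSum
import Literature.Topology.FourManifolds.ComplexProjectiveSpace

/-!
# Line «doubly_null» for the crux `RootDecompY.CP2CancellationOne` (stmt-SmoothPoincare4-17708, pooled X₁)

decomp-sp4 lens 6 gen 12 (planner draft; to be registered by the writer with
`ledger crux write <#17708 item> Lines/doubly_null.lean` + `ledger skeleton check … --crux <item>`).

THE LINE: carve X₁ along the dimension-4/5 barrier line.
* `stub_doublyNull`        (load-bearing, M–L): «M # ℂℙ² ≅ ℂℙ² ⟹ some M # (±M) ≅ S⁴» (⟺ M° × I ≅ B⁵) — the part reachable by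
  FIVE-dimensional methods (Andrews–Curtis suffices in dimension 5: Gabai–Naylor–Schwartz arXiv:2307.06388 §3 Lemmas p.8/p.9,
  Theorems p.11 decide it TRUE on the undisking-number-one Gluck twists, where X₁ is open).
* `stub_doublyNullStandard` (declared residual, XL/open): «some M # (±M) ≅ S⁴ ⟹ M ≅ S⁴» (a homotopy ball B with B × I ≅ B⁵
  is B⁴) — below `OneStabInvertible.InvertibleStandard` (#18065) and below smooth Schoenflies.
* `CP2CancellationOne_of` concludes the crux BY NAME from the two stubs (kernel, no sorry outside `stub_*`).
Both stubs are implied by `SmoothPoincare4` and by the crux itself (kernel file v12/DoublyNull.lean: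
`dissolvableDoublyNull_of_cp2CancellationOne`, `doublyNullStandard_of_spc4`), neither implies the crux or the summit cheaply
(v12/Probes.lean), and `X₁ ⟺ stub_doublyNull ∧ (stub_doublyNullStandard restricted to dissolvable M)` (kernel `cp2CancellationOne_iff`).
-/

noncomputable section

set_option linter.dupNamespace false

open scoped Manifold ContDiff

namespace Summit.SmoothPoincare4.SmoothPoincare4.Cruxes.CP2CancellationOne.DoublyNull

/-- STUB (load-bearing): DissolvableDoublyNull — «M # ℂℙ² ≅ ℂℙ² ⟹ M # (±M) ≅ S⁴» for smooth homotopy 4-spheres. -/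
theorem stub_doublyNull :
    ∀ (M : Type) [TopologicalSpace M] [T2Space M] [SecondCountableTopology M] [ChartedSpace (EuclideanSpace ℝ (Fin 4)) M] [IsManifold (𝓡 4) ∞ M], ContinuousMap.HomotopyEquiv M (Metric.sphere (0 : EuclideanSpace ℝ (Fin 5)) 1) → (∃ (P : Type) (_ : TopologicalSpace P) (_ : T2Space P) (_ : SecondCountableTopology P) (_ : ChartedSpace (EuclideanSpace ℝ (Fin 4)) P) (_ : IsManifold (𝓡 4) ∞ P), Literature.Topology.FourManifolds.IsConnectedSum (𝓡 4) (𝓡 4) (𝓡 4) M Literature.Topology.FourManifolds.ComplexProjectivePlane P ∧ Nonempty (P ≃ₘ⟮𝓡 4, 𝓡 4⟯ Literature.Topology.FourManifolds.ComplexProjectivePlane)) → ∃ (Q : Type) (_ : TopologicalSpace Q) (_ : T2Space Q) (_ : SecondCountableTopology Q) (_ : ChartedSpace (EuclideanSpace ℝ (Fin 4)) Q) (_ : IsManifold (𝓡 4) ∞ Q), Literature.Topology.FourManifolds.IsConnectedSum (𝓡 4) (𝓡 4) (𝓡 4) M M Q ∧ Nonempty (Q ≃ₘ⟮𝓡 4,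 𝓡 4⟯ (Metric.sphere (0 : EuclideanSpace ℝ (Fin 5)) 1)) := by
  sorry

/-- STUB (declared residual): DoublyNullStandard — «M # (±M) ≅ S⁴ ⟹ M ≅ S⁴» for smooth homotopy 4-spheres. -/
theorem stub_doublyNullStandard :
    ∀ (M : Type) [TopologicalSpace M] [T2Space M] [SecondCountableTopology M] [ChartedSpace (EuclideanSpace ℝ (Fin 4)) M] [IsManifold (𝓡 4) ∞ M], ContinuousMap.HomotopyEquiv M (Metric.sphere (0 : EuclideanSpace ℝ (Fin 5)) 1) → (∃ (Q : Type) (_ : TopologicalSpace Q) (_ : T2Space Q) (_ : SecondCountableTopology Q) (_ : ChartedSpace (EuclideanSpace ℝ (Fin 4)) Q) (_ : IsManifold (𝓡 4) ∞ Q), Literature.Topology.FourManifolds.IsConnectedSum (𝓡 4) (𝓡 4) (𝓡 4) M M Q ∧ Nonempty (Q ≃ₘ⟮𝓡 4, 𝓡 4⟯ (Metric.sphere (0 : EuclideanSpace ℝ (Fin 5)) 1))) → Nonempty (M ≃ₘ⟮𝓡 4, 𝓡 4⟯ (Metric.sphere (0 : EuclideanSpace ℝ (Fin 5)) 1)) :=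 by
  sorry

/-- The line concludes the crux BY NAME and USES both registered stubs. -/
theorem CP2CancellationOne_of :
    Summit.SmoothPoincare4.SmoothPoincare4.Theses.RootDecompY.CP2CancellationOne := by
  intro M _ _ _ _ _ e hdis
  exact stub_doublyNullStandard M e (stub_doublyNull M e hdis)

end Summit.SmoothPoincare4.SmoothPoincare4.Cruxes.CP2CancellationOne.DoublyNull

end
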